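import Mathlib
import Summits.QuantumFields.YangMills.Theses.PencilRigidity

/-!
# Alternation lemma (route PencilRigidity, item stmt-QuantumFields-11689)

If `t₀ < t₁ < ⋯ < t_{n-1}` and a real polynomial `q` satisfies `(-1)^i q(t_i) ≥ 0` for every `i`,
then `q = 0` or `deg q ≥ n - 1`.

Proof. If `natDegree q + 1 < n`, the `(n-1)`-st coefficient of `q` vanishes; by the
divided-difference identity `Lagrange.coeff_eq_sum` it equals
`∑ i, q(t_i) / ∏_{j ≠ i} (t_i - t_j)`.  The nodal product `∏_{j ≠ i} (t_i - t_j)` has sign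
`(-1)^(n-1-i)`, so after multiplying by `(-1)^(n-1)` the sum is a sum of non-negative terms
`((-1)^i q(t_i)) · ((-1)^(n-1-i) / ∏_{j ≠ i} (t_i - t_j))`, each of which must vanish; hence `q`
vanishes at the `n` distinct nodes and, having degree `< n`, is zero
(`Polynomial.eq_zero_of_degree_lt_of_eval_index_eq_zero`).
-/

namespace Summit.QuantumFields.YangMills.Theorems

open Finset Polynomial

/-- Sign of the nodal product at strictly increasing nodes: if `t : Fin n → ℝ` is strictly
monotone then `(-1)^(n-1-i) * ∏_{j ≠ i} (t i - t j) > 0` for every node index `i`. -/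
theorem alternation_nodal_prod_pos {n : ℕ} {t : Fin n → ℝ} (ht : StrictMono t) (i : Fin n) :
    0 < (-1 : ℝ) ^ (n - 1 - (i : ℕ)) * ∏ j ∈ univ.erase i, (t i - t j) := by
  classical
  have hsplit : univ.erase i = Finset.Iio i ∪ Finset.Ioi i := by
    ext j
    simp only [mem_erase, mem_univ, and_true, mem_union, Finset.mem_Iio, Finset.mem_Ioi]
    exact ⟨fun h => lt_or_gt_of_ne h, fun h => h.elim ne_of_lt ne_of_gt⟩
  have hdisj : Disjoint (Finset.Iio i) (Finset.Ioi i) := by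
    rw [Finset.disjoint_left]
    intro j hj hj'
    exact lt_asymm (Finset.mem_Iio.mp hj) (Finset.mem_Ioi.mp hj')
  rw [hsplit, prod_union hdisj, ← Fin.card_Ioi i, ← prod_const, mul_left_comm, ← prod_mul_distrib]
  refine mul_pos (prod_pos fun j hj => ?_) (prod_pos fun j hj => ?_)
  · exact sub_pos.mpr (ht (Finset.mem_Iio.mp hj))
  · have hlt : t i < t j := ht (Finset.mem_Ioi.mp hj)
    linarith

/-- **Alternation lemma** (item stmt-QuantumFields-11689 of route PencilRigidity): if
`t₀ < ⋯ < t_{n-1}` and `(-1)^i q(t_i) ≥ 0` for all `i`, then `q = 0` or `n ≤ natDegree q + 1`.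
Proved via the divided-difference identity `Lagrange.coeff_eq_sum` and the nodal sign lemma
`alternation_nodal_prod_pos`. -/
theorem alternationLemma_proof :
    Summit.QuantumFields.YangMills.Theses.PencilRigidity.AlternationLemma := by
  unfold Summit.QuantumFields.YangMills.Theses.PencilRigidity.AlternationLemma
  intro n t ht q hq
  classical
  by_contra h
  push Not at h
  obtain ⟨hq0, hlt⟩ := h
  -- the nodes are distinct
  have hinj : Set.InjOn t (univ : Finset (Fin n)) := ht.injective.injOn
  -- degree bound `deg q < n`
  have hdeg : q.degree < #(univ : Finset (Fin n)) := by
    rw [card_univ, Fintype.card_fin]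
    exact degree_le_natDegree.trans_lt (by exact_mod_cast (by omega : q.natDegree < n))
  -- the `(n-1)`-st coefficient vanishes
  have hcoeff : q.coeff (#(univ : Finset (Fin n)) - 1) = 0 := by
    rw [card_univ, Fintype.card_fin]
    exact coeff_eq_zero_of_natDegree_lt (by omega)
  -- divided-difference identity
  have hsum := Lagrange.coeff_eq_sum hinj hdeg
  rw [hcoeff] at hsum
  -- each term, multiplied by `(-1)^(n-1)`, is (non-negative) × (positive)
  have hpos : ∀ i : Fin n,
      0 < (-1 : ℝ) ^ (n - 1 - (i : ℕ)) / ∏ j ∈ univ.erase i, (t i - t j) := fun i =>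
    div_pos_iff.mpr (mul_pos_iff.mp (alternation_nodal_prod_pos ht i))
  have hterm : ∀ i : Fin n,
      (-1 : ℝ) ^ (n - 1) * (q.eval (t i) / ∏ j ∈ univ.erase i, (t i - t j)) =
        ((-1 : ℝ) ^ (i : ℕ) * q.eval (t i)) *
          ((-1 : ℝ) ^ (n - 1 - (i : ℕ)) / ∏ j ∈ univ.erase i, (t i - t j)) := by
    intro i
    have hpow : (-1 : ℝ) ^ (n - 1) = (-1) ^ (i : ℕ) * (-1) ^ (n - 1 - (i : ℕ)) := by
      rw [← pow_add]
      congr 1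
      omega
    rw [hpow]
    ring
  have hzero : ∑ i : Fin n, ((-1 : ℝ) ^ (i : ℕ) * q.eval (t i)) *
      ((-1 : ℝ) ^ (n - 1 - (i : ℕ)) / ∏ j ∈ univ.erase i, (t i - t j)) = 0 := by
    rw [← Finset.sum_congr rfl fun i _ => hterm i, ← mul_sum, ← hsum, mul_zero]
  -- hence every node is a root of `q`
  have hroot : ∀ i ∈ (univ : Finset (Fin n)), q.eval (t i) = 0 := by
    intro i hi
    have hi0 := (sum_eq_zero_iff_of_nonneg (fun j _ => mul_nonneg (hq j) (hpos j).le)).mp hzero i hi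
    rcases mul_eq_zero.mp hi0 with h0 | h0
    · rcases mul_eq_zero.mp h0 with h1 | h1
      · exact absurd h1 (pow_ne_zero _ (by norm_num))
      · exact h1
    · exact absurd h0 (hpos i).ne'
  exact hq0 (Polynomial.eq_zero_of_degree_lt_of_eval_index_eq_zero univ hinj hdeg hroot)

end Summit.QuantumFields.YangMills.Theorems
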